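import Literature.IUT.HodgeTheaters.PuncturedEllipticProLModelShadowPosition
import Literature.IUT.HodgeTheaters.PuncturedEllipticProLModelFrattiniXbar
import Literature.IUT.HodgeTheaters.PuncturedEllipticGeomOriginStandardBasis
import Literature.IUT.HodgeTheaters.PuncturedEllipticCoveringsCor12OfFreePro
import Literature.AnabelianGeometry.AbsoluteAnabelian.FreeProSigmaOpenSubgroups
import HarnessLib

/-!
# An infinite pro-`l` model of [IUTchI] §1, part 13: the FRATTINI COMPARISON `Δ_X̲′/Φ ≅ Π_X̲/Φ` along the shadow

Mochizuki, *Inter-universal Teichmüller theory I*, kurims manuscript (May 2020), §1 p. 37 l. 30–31: "`Δ_X̲ ↠ Δ_X̲^{ab} ⊗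
(ℤ/lℤ)`" for `X̲ := C̲ ×_C X` ([IUTchI] §1 p.37) [claim: Mochizuki2012, status: disputed]; classical input [AbsTopI] Lemma
4.5 (i) p. 54 (`Δ_X` free profinite of rank `2`; Schreier: `Δ_X̲` free of rank `l + 1`) [cite: MochizukiAbsTopI2012, Lemma
4.5 (i) p.54].  (D-0012 claim key; series status DISPUTED — PROOF-ONLY module; nothing of the series is asserted, no side
is taken on [IUTchIII] Cor. 3.12.)

Cell abc-iut, seat abc-iut-L5-d4 (gen 12), row R45 «COR12-MODL-LAWS-DERIVE@M_l», brick B4c.  `F : Δ_X′ → P` is a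
shadow homomorphism in standard position (parts 9, 11: `F a = a`, `F b = (B_0)`, `b ∈ Π_C̲′`, `F⁻¹(Π_X̲) = Δ_X̲′`);
`Φ′ := Ker(Δ_X̲′ ↠ Δ_X̲′^{ab} ⊗ ℤ/l)` (abc-iut-L5-t1's `modLKer`), `Φ := ` the model's (part 10: `[Π_X̲ : Φ] = l^{l+1}`).
* `relIndex_modLKer_deltaXbar_eq` — `[Δ_X̲′ : Φ′] = l^{l+1}` for a `GeomOrigin`-type datum (Schreier rank `l + 1` of the
  open index-`l` subgroup `Δ_X̲′` of the free `Δ_X′`, then abc-iut-L5-t1's `relIndex_modPowCommutatorClosure_eq_of_isFreeProOn`);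
* `map_modLKer_le` — `F(Φ′) ⊆ Φ` (commutators to commutators, `l`-th powers to `l`-th powers, closure by continuity);
* `map_deltaXbar_eq` — `F(Δ_X̲′) = Π_X̲`;
* **`comap_modLKer_inf_eq`** — `F⁻¹(Φ) ∩ Δ_X̲′ = Φ′` (both have index `l^{l+1}` in `Δ_X̲′` and one contains the other),
  i.e. `F` induces `Δ_X̲′/Φ′ ⥲ Π_X̲/Φ ≅ (ℤ/l)^{l+1}`; `map_modLKer_eq` — `F(Φ′) = Φ`;
* `mem_of_map_mem` / **`relIndex_eq_relIndex_map`** — for `Φ′ ⊆ A ⊆ B ⊆ Δ_X̲′`: membership and the index `[B : A]`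
  are read off the images `F(A) ⊆ F(B)`;
* **`map_inertia_eq`** — `F(I′_x) = D_k`, `k = (F g_x)·0`, for the cusp inertia `I′_x = ⟨g_x [a,b] g_x⁻¹⟩⁻`.
HONEST LABEL: derivation device over OUR interfaces (the `Δ_X̲`-abelian shadow of a GeomOrigin datum); no `sorry`.
-/

noncomputable section

namespace Literature.IUT.HodgeTheaters

namespace PuncturedEllipticData

namespace ProLModel

open DihedralGroup _root_.Topology Literature.AnabelianGeometry.AbsoluteAnabelian
open scoped Pointwise commutatorElement

universe u

variable (l : ℕ) [Fact l.Prime]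

/-! ### `[Δ_X̲′ : Φ′] = l^{l+1}` (Schreier) -/

/-- `Δ_X̲ ⊆ Δ_X`, viewed inside `Δ_X`, is open (the trace of the open `Π_C̲`). ([IUTchI] §1 p.37)
[claim: Mochizuki2012, status: disputed] -/
theorem isOpen_deltaXbar_subgroupOf (D' : PuncturedEllipticData.{u}) :
    IsOpen ((D'.DeltaXbar.subgroupOf (D'.PiX ⊓ D'.DeltaC) : Subgroup ↥(D'.PiX ⊓ D'.DeltaC)) :
      Set ↥(D'.PiX ⊓ D'.DeltaC)) := by
  have e : ((D'.DeltaXbar.subgroupOf (D'.PiX ⊓ D'.DeltaC) : Subgroup ↥(D'.PiX ⊓ D'.DeltaC)) :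
      Set ↥(D'.PiX ⊓ D'.DeltaC)) = Subtype.val ⁻¹' (D'.PiCbar : Set D'.PiC) := by
    ext x
    rw [SetLike.mem_coe, mem_deltaXbar_subgroupOf_iff, Set.mem_preimage, SetLike.mem_coe]
  rw [e]
  exact D'.isOpen_piCbar.preimage continuous_subtype_val

/-- **`[Δ_X̲′ : Ker(Δ_X̲′ ↠ Δ_X̲′^{ab} ⊗ ℤ/l)] = l^{l+1}`** for a datum with `Δ_X′` free profinite on two generators and
`[Π_X : Π_X̲] = l`: `Δ_X̲′` is open of index `l` in `Δ_X′`, hence free profinite of rank `(2−1)·l + 1` (Schreier,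
abc-iut-L4-t17's `IsFreeProOn.exists_isFreeProOn_of_isOpen`), and the count is abc-iut-L5-t1's
`relIndex_modPowCommutatorClosure_eq_of_isFreeProOn`. ([IUTchI] §1 p.37) [claim: Mochizuki2012, status: disputed] -/
theorem relIndex_modLKer_deltaXbar_eq (D' : PuncturedEllipticData.{u}) {gens : Fin 2 → ↥(D'.PiX ⊓ D'.DeltaC)}
    (hfree : IsFreeProOn ↥(D'.PiX ⊓ D'.DeltaC) Set.univ gens) (hX : D'.PiXbar.relIndex D'.PiX = D'.l) :
    D'.modLKer.relIndex D'.DeltaXbar = D'.l ^ (D'.l + 1) := by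
  haveI : CompactSpace ↥(D'.PiX ⊓ D'.DeltaC) :=
    isCompact_iff_compactSpace.mp D'.isClosed_piX_inf_deltaC.isCompact
  haveI : Fact (1 < D'.l) := ⟨by have := D'.five_le; omega⟩
  set N := D'.DeltaXbar.subgroupOf (D'.PiX ⊓ D'.DeltaC) with hN
  obtain ⟨m, gens', hfree', hm⟩ := hfree.exists_isFreeProOn_of_isOpen (by norm_num) N (isOpen_deltaXbar_subgroupOf D')
  rw [index_deltaXbar_subgroupOf_of_hX hX] at hm
  have hm' : m = D'.l + 1 := by rw [hm]; ring
  subst hm'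
  -- transport along `N ≃ₜ* Δ_X̲′`
  let e₀ : N ≃* ↥D'.DeltaXbar := Subgroup.subgroupOfEquivOfLe deltaXbar_le_deltaX
  let e : N ≃ₜ* ↥D'.DeltaXbar :=
    { toMulEquiv := e₀
      continuous_toFun := by
        apply Continuous.subtype_mk
        exact continuous_subtype_val.comp continuous_subtype_val
      continuous_invFun := by
        apply Continuous.subtype_mk
        apply Continuous.subtype_mk
        exact continuous_subtype_val }
  have hfree'' := hfree'.of_continuousMulEquiv e
  have h := relIndex_modPowCommutatorClosure_eq_of_isFreeProOn D'.DeltaXbar D'.isClosed_deltaXbar hfree'' D'.l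
  rw [modLKer]
  exact h

variable {D' : PuncturedEllipticData.{u}} {gens : Fin 2 → ↥(D'.PiX ⊓ D'.DeltaC)}
  (hfree : IsFreeProOn ↥(D'.PiX ⊓ D'.DeltaC) Set.univ gens) (F : ↥(D'.PiX ⊓ D'.DeltaC) →* P l)
  (hF : Continuous F) (h0 : F (gens 0) = elA l 1) (h1 : F (gens 1) = inN l (δ l 0))
  (hb : (gens 1 : D'.PiC) ∈ D'.PiCbar) (C : D'.CuspGalois) (hX : D'.PiXbar.relIndex D'.PiX = D'.l)

/-! ### `F(Δ_X̲′) = Π_X̲` and `F(Φ′) ⊆ Φ` -/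

include hfree hF h0 h1 hb C hX in
/-- `F⁻¹(Π_X̲) = Δ_X̲′` (part 11, with the normality and the index supplied by the cusp action and `[Π_X : Π_X̲] = l`).
([IUTchI] §1 p.37) [claim: Mochizuki2012, status: disputed] -/
theorem comap_PiXbar_eq (hl : D'.l = l) :
    (PiXm l ⊓ PiCbarm l).comap F = D'.DeltaXbar.subgroupOf (D'.PiX ⊓ D'.DeltaC) :=
  comap_shadow_eq_of_standardPosition l hfree F hF h0 h1 hb C.normal_deltaXbar_subgroupOf
    (hl ▸ index_deltaXbar_subgroupOf_of_hX hX)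

include hfree hF h0 h1 hb C hX in
/-- **`F(Δ_X̲′) = Π_X̲`.** ([IUTchI] §1 p.37) [claim: Mochizuki2012, status: disputed] -/
theorem map_deltaXbar_eq (hl : D'.l = l) :
    (D'.DeltaXbar.subgroupOf (D'.PiX ⊓ D'.DeltaC)).map F = PiXm l ⊓ PiCbarm l := by
  rw [← comap_PiXbar_eq l hfree F hF h0 h1 hb C hX hl, Subgroup.map_comap_eq, inf_eq_right]
  exact (inf_le_left.trans (PiXm_le_range_shadow l F hF h0 h1))

include hfree hF h0 h1 hb C hX in
/-- **`F(Φ′) ⊆ Φ`**: the shadow maps `Ker(Δ_X̲′ ↠ Δ_X̲′^{ab} ⊗ ℤ/l)` into the model's `Ker(Π_X̲ ↠ Π_X̲^{ab} ⊗ ℤ/l)`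
(commutators of `Δ_X̲′` go to commutators of `Π_X̲ = F(Δ_X̲′)`, `l`-th powers to `l`-th powers, and the closed
preimage contains the closure). ([IUTchI] §1 p.37) [claim: Mochizuki2012, status: disputed] -/
theorem map_modLKer_le (h5 : 5 ≤ l) (hl : D'.l = l) :
    (D'.modLKer.subgroupOf (D'.PiX ⊓ D'.DeltaC)).map F ≤ (datum l h5).modLKer := by
  classical
  rw [Subgroup.map_le_iff_le_comap]
  set K : Subgroup ↥(D'.PiX ⊓ D'.DeltaC) := ((datum l h5).modLKer).comap F with hK
  have hKc : IsClosed (K : Set ↥(D'.PiX ⊓ D'.DeltaC)) := (datum l h5).isClosed_modLKer.preimage hF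
  -- the image `K♯` of `K` in `Π_C′` is closed and contains the commutators and `l`-th powers of `Δ_X̲′`
  have hemb : Topology.IsClosedEmbedding (Subtype.val : ↥(D'.PiX ⊓ D'.DeltaC) → D'.PiC) :=
    D'.isClosed_piX_inf_deltaC.isClosedEmbedding_subtypeVal
  have hK'c : IsClosed ((K.map (D'.PiX ⊓ D'.DeltaC).subtype : Subgroup D'.PiC) : Set D'.PiC) := by
    rw [Subgroup.coe_map]; exact hemb.isClosedMap _ hKc
  have hN : ∀ {x : D'.PiC} (hx : x ∈ D'.DeltaXbar),
      F ⟨x, deltaXbar_le_deltaX hx⟩ ∈ PiXm l ⊓ PiCbarm l := fun {x} hx => by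
    rw [← Subgroup.mem_comap, comap_PiXbar_eq l hfree F hF h0 h1 hb C hX hl, Subgroup.mem_subgroupOf]; exact hx
  have hW : PiXm l ⊓ PiCbarm l = (datum l h5).DeltaXbar := (deltaXbar_eq l h5).symm
  have hle : D'.modLKer ≤ K.map (D'.PiX ⊓ D'.DeltaC).subtype := by
    rw [modLKer]
    refine Subgroup.topologicalClosure_minimal _ (sup_le ?_ ?_) hK'c
    · rw [Subgroup.commutator_le]
      intro x hx y hy
      refine ⟨⁅(⟨x, deltaXbar_le_deltaX hx⟩ : ↥(D'.PiX ⊓ D'.DeltaC)), ⟨y, deltaXbar_le_deltaX hy⟩⁆, ?_, rfl⟩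
      change _ ∈ K
      rw [hK, Subgroup.mem_comap, map_commutatorElement]
      refine Subgroup.le_topologicalClosure _ (Subgroup.mem_sup_left ?_)
      exact Subgroup.commutator_mem_commutator (hW ▸ hN hx) (hW ▸ hN hy)
    · rw [Subgroup.closure_le]
      rintro _ ⟨x, hx, rfl⟩
      refine ⟨(⟨x, deltaXbar_le_deltaX hx⟩ : ↥(D'.PiX ⊓ D'.DeltaC)) ^ D'.l, ?_, rfl⟩
      change _ ∈ K
      rw [hK, Subgroup.mem_comap, map_pow]
      refine Subgroup.le_topologicalClosure _ (Subgroup.mem_sup_right (Subgroup.subset_closure ?_))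
      exact ⟨F ⟨x, deltaXbar_le_deltaX hx⟩, hW ▸ hN hx, by rw [hl]⟩
  intro g hg
  rw [Subgroup.mem_subgroupOf] at hg
  obtain ⟨k, hk, hkg⟩ := hle hg
  have : k = g := Subtype.ext hkg
  rw [← this]; exact hk

/-! ### The comparison `F⁻¹(Φ) ∩ Δ_X̲′ = Φ′` -/

include hfree hF h0 h1 hb C hX in
/-- **FRATTINI COMPARISON: `F⁻¹(Φ) ∩ Δ_X̲′ = Φ′`.**  `Φ′ ⊆ F⁻¹(Φ) ∩ Δ_X̲′ ⊆ Δ_X̲′`; the outer index is `l^{l+1}`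
(Schreier), and so is the inner one: `F|Δ_X̲′ : Δ_X̲′ ↠ Π_X̲` is onto and `[Π_X̲ : Φ] = l^{l+1}` (part 10); hence the two
subgroups coincide — `F` induces `Δ_X̲′/Φ′ ⥲ Π_X̲/Φ`. ([IUTchI] §1 p.37) [claim: Mochizuki2012, status: disputed] -/
theorem comap_modLKer_inf_eq (h5 : 5 ≤ l) (hl : D'.l = l) :
    ((datum l h5).modLKer).comap F ⊓ D'.DeltaXbar.subgroupOf (D'.PiX ⊓ D'.DeltaC) =
      D'.modLKer.subgroupOf (D'.PiX ⊓ D'.DeltaC) := by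
  classical
  haveI : Fact (1 < l) := ⟨(Fact.out : l.Prime).one_lt⟩
  set N := D'.DeltaXbar.subgroupOf (D'.PiX ⊓ D'.DeltaC) with hNdef
  set A := ((datum l h5).modLKer).comap F ⊓ N with hAdef
  set Φ' := D'.modLKer.subgroupOf (D'.PiX ⊓ D'.DeltaC) with hΦ'
  have hΦ'A : Φ' ≤ A := le_inf (Subgroup.map_le_iff_le_comap.1 (map_modLKer_le l hfree F hF h0 h1 hb C hX h5 hl))
    (Subgroup.comap_mono D'.modLKer_le_deltaXbar)
  have hAN : A ≤ N := inf_le_right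
  have hpow : (l : ℕ) ^ (l + 1) ≠ 0 := pow_ne_zero _ (Fact.out : l.Prime).ne_zero
  -- `[N : Φ′] = l^{l+1}`
  have hΦ'N : Φ'.relIndex N = l ^ (l + 1) := by
    rw [hΦ', hNdef, Subgroup.relIndex_subgroupOf deltaXbar_le_deltaX, relIndex_modLKer_deltaXbar_eq D' hfree hX, hl]
  -- `[N : A] = l^{l+1}` via the surjection `F| : N ↠ Π_X̲`
  have hmapN : N.map F = PiXm l ⊓ PiCbarm l := map_deltaXbar_eq l hfree F hF h0 h1 hb C hX hl
  have hAN' : A.relIndex N = l ^ (l + 1) := by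
    have hsurj := F.subgroupMap_surjective N
    have hcomap : (((datum l h5).modLKer).subgroupOf (N.map F)).comap (F.subgroupMap N) = A.subgroupOf N := by
      ext n
      simp only [Subgroup.mem_comap, Subgroup.mem_subgroupOf, hAdef, Subgroup.mem_inf, MonoidHom.subgroupMap_apply_coe]
      exact ⟨fun h => ⟨h, n.2⟩, fun h => h.1⟩
    have hidx := Subgroup.index_comap_of_surjective hsurj (H := ((datum l h5).modLKer).subgroupOf (N.map F))
    rw [hcomap] at hidx
    change A.relIndex N = ((datum l h5).modLKer).relIndex (N.map F) at hidx
    rw [hidx, hmapN, ← deltaXbar_eq l h5, modLKer_relIndex_datum]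
  -- squeeze
  have hmul := Subgroup.relIndex_mul_relIndex Φ' A N hΦ'A hAN
  rw [hΦ'N, hAN'] at hmul
  have h1' : Φ'.relIndex A = 1 := by
    have := mul_left_eq_self₀.mp hmul
    exact this.resolve_right hpow
  exact le_antisymm (Subgroup.relIndex_eq_one.mp h1') hΦ'A

include hfree hF h0 h1 hb C hX in
/-- **`F(Φ′) = Φ`.** ([IUTchI] §1 p.37) [claim: Mochizuki2012, status: disputed] -/
theorem map_modLKer_eq (h5 : 5 ≤ l) (hl : D'.l = l) :
    (D'.modLKer.subgroupOf (D'.PiX ⊓ D'.DeltaC)).map F = (datum l h5).modLKer := by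
  refine le_antisymm (map_modLKer_le l hfree F hF h0 h1 hb C hX h5 hl) fun w hw => ?_
  have hwW : w ∈ PiXm l ⊓ PiCbarm l := by
    rw [← deltaXbar_eq l h5]; exact (datum l h5).modLKer_le_deltaXbar hw
  rw [← map_deltaXbar_eq l hfree F hF h0 h1 hb C hX hl] at hwW
  obtain ⟨n, hn, rfl⟩ := hwW
  refine ⟨n, ?_, rfl⟩
  rw [← comap_modLKer_inf_eq l hfree F hF h0 h1 hb C hX h5 hl]
  exact ⟨hw, hn⟩

/-! ### Reading subgroups between `Φ′` and `Δ_X̲′` off their images -/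

include hfree hF h0 h1 hb C hX in
/-- **Pull-back of membership**: for `Φ′ ⊆ A ⊆ Δ_X̲′` and `n ∈ Δ_X̲′`, `F n ∈ F(A) ⇒ n ∈ A` (the discrepancy lies in
`Ker F ∩ Δ_X̲′ ⊆ F⁻¹(Φ) ∩ Δ_X̲′ = Φ′ ⊆ A`). ([IUTchI] §1 p.37) [claim: Mochizuki2012, status: disputed] -/
theorem mem_of_map_mem (h5 : 5 ≤ l) (hl : D'.l = l) {A : Subgroup D'.PiC} (hΦA : D'.modLKer ≤ A)
    (hAX : A ≤ D'.DeltaXbar) {n : ↥(D'.PiX ⊓ D'.DeltaC)} (hn : (n : D'.PiC) ∈ D'.DeltaXbar)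
    (hFn : F n ∈ (A.subgroupOf (D'.PiX ⊓ D'.DeltaC)).map F) : (n : D'.PiC) ∈ A := by
  obtain ⟨a, ha, hFa⟩ := hFn
  change (a : D'.PiC) ∈ A at ha
  have hker : a⁻¹ * n ∈ ((datum l h5).modLKer).comap F ⊓ D'.DeltaXbar.subgroupOf (D'.PiX ⊓ D'.DeltaC) := by
    refine Subgroup.mem_inf.mpr ⟨?_, ?_⟩
    · rw [Subgroup.mem_comap, map_mul, map_inv, hFa, inv_mul_cancel]; exact Subgroup.one_mem _
    · rw [Subgroup.mem_subgroupOf, Subgroup.coe_mul, Subgroup.coe_inv]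
      exact D'.DeltaXbar.mul_mem (D'.DeltaXbar.inv_mem (hAX ha)) hn
  rw [comap_modLKer_inf_eq l hfree F hF h0 h1 hb C hX h5 hl, Subgroup.mem_subgroupOf, Subgroup.coe_mul,
    Subgroup.coe_inv] at hker
  have h := A.mul_mem ha (hΦA hker)
  rwa [mul_inv_cancel_left] at h

include hfree hF h0 h1 hb C hX in
/-- **Indices between `Φ′` and `Δ_X̲′` are read off the shadow**: for `Φ′ ⊆ A ⊆ B ⊆ Δ_X̲′`,
`[B : A] = [F(B) : F(A)]` (`F|B : B ↠ F(B)` pulls `F(A)` back to exactly `A`). ([IUTchI] §1 p.37)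
[claim: Mochizuki2012, status: disputed] -/
theorem relIndex_eq_relIndex_map (h5 : 5 ≤ l) (hl : D'.l = l) {A B : Subgroup D'.PiC} (hΦA : D'.modLKer ≤ A)
    (hAB : A ≤ B) (hBX : B ≤ D'.DeltaXbar) :
    A.relIndex B = ((A.subgroupOf (D'.PiX ⊓ D'.DeltaC)).map F).relIndex ((B.subgroupOf (D'.PiX ⊓ D'.DeltaC)).map F) := by
  classical
  set AΔ := A.subgroupOf (D'.PiX ⊓ D'.DeltaC) with hAΔ
  set BΔ := B.subgroupOf (D'.PiX ⊓ D'.DeltaC) with hBΔ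
  have hsurj := F.subgroupMap_surjective BΔ
  have hcomap : ((AΔ.map F).subgroupOf (BΔ.map F)).comap (F.subgroupMap BΔ) = AΔ.subgroupOf BΔ := by
    ext b
    simp only [Subgroup.mem_comap, Subgroup.mem_subgroupOf, MonoidHom.subgroupMap_apply_coe]
    constructor
    · intro h
      have hbB : ((b : ↥(D'.PiX ⊓ D'.DeltaC)) : D'.PiC) ∈ B := b.2
      exact mem_of_map_mem l hfree F hF h0 h1 hb C hX h5 hl hΦA (hAB.trans hBX) (hBX hbB) h
    · intro h
      exact ⟨(b : ↥(D'.PiX ⊓ D'.DeltaC)), h, rfl⟩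
  have hidx := Subgroup.index_comap_of_surjective hsurj (H := (AΔ.map F).subgroupOf (BΔ.map F))
  rw [hcomap] at hidx
  change AΔ.relIndex BΔ = (AΔ.map F).relIndex (BΔ.map F) at hidx
  rw [← hidx, hAΔ, hBΔ, Subgroup.relIndex_subgroupOf (hBX.trans deltaXbar_le_deltaX)]

/-! ### `F(I′_x) = D_k` -/

omit [Fact l.Prime] in
/-- Conjugation carries the closure of a cyclic subgroup into the closure of the conjugate cyclic subgroup.
[claim: Mochizuki2012, status: disputed] -/
theorem conj_mem_topologicalClosure_zpowers {G : Type*} [Group G] [TopologicalSpace G] [IsTopologicalGroup G]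
    (h u : G) {y : G} (hy : y ∈ (Subgroup.zpowers u).topologicalClosure) :
    h * y * h⁻¹ ∈ (Subgroup.zpowers (h * u * h⁻¹)).topologicalClosure := by
  have hcont : Continuous fun y : G => h * y * h⁻¹ := (continuous_const.mul continuous_id).mul continuous_const
  let S : Subgroup G := ((Subgroup.zpowers (h * u * h⁻¹)).topologicalClosure).comap (MulAut.conj h).toMonoidHom
  have hS : IsClosed (S : Set G) := (Subgroup.isClosed_topologicalClosure _).preimage hcont
  have hle : (Subgroup.zpowers u).topologicalClosure ≤ S := by
    refine Subgroup.topologicalClosure_minimal _ ?_ hS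
    rw [Subgroup.zpowers_le]
    change h * u * h⁻¹ ∈ (Subgroup.zpowers (h * u * h⁻¹)).topologicalClosure
    exact Subgroup.le_topologicalClosure _ (Subgroup.mem_zpowers _)
  exact hle hy

include hF h0 h1 in
/-- **`F(I′_x) = D_k`, `k = (F g)·0`**: the shadow maps the cusp inertia group `I′_x = ⟨g [a,b] g⁻¹⟩⁻ ⊆ Δ_X′` ONTO the
model's inertia line `D_k` (into: part 9; onto: `D_k = (F g)·⟨(c_0)⟩⁻·(F g)⁻¹`, `(c_0) = F [a,b]`, and the image of
the compact `⟨g [a,b] g⁻¹⟩⁻` is closed). ([IUTchI] §1 p.37) [claim: Mochizuki2012, status: disputed] -/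
theorem map_inertia_eq {I : Subgroup D'.PiC} {g : D'.PiC} (hg : g ∈ D'.PiX ⊓ D'.DeltaC)
    (hI : I = (Subgroup.zpowers (g * ((gens 0 : D'.PiC) * (gens 1 : D'.PiC) * (gens 0 : D'.PiC)⁻¹ *
      (gens 1 : D'.PiC)⁻¹) * g⁻¹)).topologicalClosure) :
    (I.subgroupOf (D'.PiX ⊓ D'.DeltaC)).map F = Dm l (ArrowModel.cuspAct l (toDih l (F ⟨g, hg⟩).right) 0) := by
  classical
  haveI : CompactSpace ↥(D'.PiX ⊓ D'.DeltaC) :=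
    isCompact_iff_compactSpace.mp D'.isClosed_piX_inf_deltaC.isCompact
  set k := ArrowModel.cuspAct l (toDih l (F ⟨g, hg⟩).right) 0 with hk
  refine le_antisymm ?_ ?_
  · rintro _ ⟨y, hy, rfl⟩
    exact shadowHom_inertia_le l F hF h0 h1 hg hI y hy
  -- the conjugated commutator inside `Δ_X′`
  set c : ↥(D'.PiX ⊓ D'.DeltaC) := gens 0 * gens 1 * (gens 0)⁻¹ * (gens 1)⁻¹ with hc
  set z : ↥(D'.PiX ⊓ D'.DeltaC) := ⟨g, hg⟩ * c * ⟨g, hg⟩⁻¹ with hz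
  have hzval : (z : D'.PiC) = g * ((gens 0 : D'.PiC) * (gens 1 : D'.PiC) * (gens 0 : D'.PiC)⁻¹ *
      (gens 1 : D'.PiC)⁻¹) * g⁻¹ := by
    simp only [hz, hc, Subgroup.coe_mul, Subgroup.coe_inv]
  have hFz : F z = F ⟨g, hg⟩ * inN l (cvec l 0) * (F ⟨g, hg⟩)⁻¹ := by
    rw [hz, map_mul, map_mul, map_inv, hc, shadowHom_commutator l F h0 h1]
  -- step 1: `⟨z⟩⁻ (in Δ_X′) ⊆ I ∩ Δ_X′`
  have h1' : (Subgroup.zpowers z).topologicalClosure ≤ I.subgroupOf (D'.PiX ⊓ D'.DeltaC) := by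
    refine Subgroup.topologicalClosure_minimal _ ?_ ?_
    · rw [Subgroup.zpowers_le, Subgroup.mem_subgroupOf, hI, hzval]
      exact Subgroup.le_topologicalClosure _ (Subgroup.mem_zpowers _)
    · rw [hI]
      exact (Subgroup.isClosed_topologicalClosure _).preimage continuous_subtype_val
  -- step 2: `D_k ⊆ F(⟨z⟩⁻)`
  refine le_trans ?_ (Subgroup.map_mono h1')
  have hclosed : IsClosed ((((Subgroup.zpowers z).topologicalClosure).map F : Subgroup (P l)) : Set (P l)) := by
    rw [Subgroup.coe_map]
    exact ((Subgroup.isClosed_topologicalClosure _).isCompact.image hF).isClosed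
  have h2 : (Subgroup.zpowers (F z)).topologicalClosure ≤ ((Subgroup.zpowers z).topologicalClosure).map F := by
    refine Subgroup.topologicalClosure_minimal _ ?_ hclosed
    rw [Subgroup.zpowers_le]
    exact ⟨z, Subgroup.le_topologicalClosure _ (Subgroup.mem_zpowers _), rfl⟩
  refine le_trans ?_ h2
  intro w hw
  rw [hk, ← conj_smul_Dm] at hw
  obtain ⟨y, hy, rfl⟩ := hw
  rw [SetLike.mem_coe, ← closure_zpowers_inN_cvec] at hy
  rw [hFz]
  exact conj_mem_topologicalClosure_zpowers _ _ hy

end ProLModel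

end PuncturedEllipticData

end Literature.IUT.HodgeTheaters
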